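import Summits.HodgeConjecture.HodgeConjecture.Theorems.Q8MonodromyBireflectionAssemblyKer
import Literature.AlgebraicTopology.SingularHomology.HomologyTwoPiecesKernelDatum
import Literature.AlgebraicGeometry.HodgeTheory.BettiTraceFormDisjointCarriers
import Literature.AlgebraicGeometry.HodgeTheory.ComplexPointsPoincareDuality
import HarnessLib

/-!
# K1Q stub S5 (v6) at a point, from the local configuration of a d6 monodromy homeomorphism (model-free homological form)

Sub-problem `HodgeConjecture`, route `Summits/HodgeConjecture/HodgeConjecture/Theses/Q8SymplecticPowers.lean` (crux K1Q
`VeryGeneralQuaternionCommutatorsInHg`, stmt-HodgeConjecture-24190, skeleton v6 stub S5 `stub_monodromyBireflectionQ`). Written by the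
prover seat `hodge-nonav-prover-Ax` (g18). HC ∕ HC_AV ∕ K1Q are NOT proved here.

`monodromyBireflection_of_localConfiguration` composes `Literature…HomologyTwoPiecesKernelDatum.twoPiecesKernelDatum` (two pieces ⇒ the
datum on `ker(τ_*² + 1)`), `Literature…BettiTraceFormDisjointCarriers.tr_cup_eq_zero_of_disjoint_carriers_two` (disjoint closures ⇒
`Qf`-orthogonality), `Literature…ComplexPointsPoincareDuality` (Poincaré duality) and
`Q8MonodromyBireflectionAssemblyKer.monodromyBireflection_of_twoBallDatum_of_ne_one_ker`, so that the ∃-clause of S5-v6 at a point `s`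
follows from data on the member `X = X_s(ℂ)` alone:

* a monodromy transformation `γ ∈ Γ_s` acting non-trivially on `ker(A² + 1)`, realised by a homeomorphism `h` (`h^* = γ`, `h_*[X] = [X]`)
  commuting with `τ_s(ℂ)`;
* open `A₁, A₂, B` with `A₁ ∪ A₂ ∪ B = X`, `closure A₁ ∩ A₂ = ∅`, `h = id` on `B`, `h(A_k) ⊆ A_k`, `τ_s(ℂ)(A_k) ⊆ A_k`,
  `j_s(ℂ)(A₁) ⊆ A₂`, `j_s(ℂ)(A₂) ⊆ A₁`, `H₂(A_k; ℚ)` finite-dimensional;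
* the LOCAL HOMOLOGICAL facts on the `τ|² = −1` part of `H₂(A_k; ℚ)`: its rank is `≤ 2` on `A₁`, `h|_* = τ|_*` there on `A₁`, and
  `h|_* τ|_* = 1` there on `A₂`.

The pieces are meant to be `X_s(ℂ) ∩ (ball at a d6 point)`: they CONTAIN the two exceptional curves `E_±` (classes fixed by `τ²`, exchanged
by `h`), which is why only the `τ|² = −1` part is constrained (there the piece looks like the free quotient `F°∕ι` of the punctured `A₃` Milnor
fibre, `Literature…PhamBrieskornA3QuotientPieceHomology`: rank `2`, `h̄_* = τ̄_*`) and why `γ ≠ 1` is asked on `ker(A² + 1)`; and `h` is the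
identity near the boundary of the balls, which is why no pointwise conjugacy to a model map is asked (review of p729611).

What remains for S5-v6 (memo `LOC6-ARCHITECTURE-Ax-g18.md` §7): the EXISTENCE of `(γ, h, A₁, A₂, B)` with these properties at one point of
each path component of the base (then `Q8MonodromyBireflectionTransport.clause_transport_family` moves the clause to every point).
-/

noncomputable section

set_option backward.isDefEq.respectTransparency false
set_option linter.dupNamespace false

open Module LinearMap CategoryTheory Set
open scoped TensorProduct
open Literature.AlgebraicTopology.SingularHomology Literature.AlgebraicGeometry Literature.AlgebraicGeometry.Motives
open Literature.AlgebraicGeometry.HodgeTheory Literature.AlgebraicGeometry.HodgeTheory.BettiUniverse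

namespace Summit.HodgeConjecture.HodgeConjecture.Theorems.Q8MonodromyBireflectionAssembly

variable {𝒳 S : SchemeOver ℂ} (π : 𝒳 ⟶ S) {τ : 𝒳 ⟶ 𝒳} (hτπ : τ ≫ π = π)

/-- `τ_s(ℂ)⁴ = id` on the points of the fibre, from `τ⁴ = 𝟙`. [cite: Fulton1998, §10.1] -/
theorem mapContinuous_fiberOverEnd_pow_four_apply (h4 : τ ≫ τ ≫ τ ≫ τ = 𝟙 𝒳) (s : AlgPoints S ℂ) (x : ComplexPoints (fiberOver π s)) :
    AlgPoints.mapContinuous (L := ℂ) (fiberOverEnd π τ hτπ s) (AlgPoints.mapContinuous (L := ℂ) (fiberOverEnd π τ hτπ s)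
      (AlgPoints.mapContinuous (L := ℂ) (fiberOverEnd π τ hτπ s) (AlgPoints.mapContinuous (L := ℂ) (fiberOverEnd π τ hτπ s) x))) = x := by
  have hττ : (τ ≫ τ) ≫ π = π := by rw [Category.assoc, hτπ, hτπ]
  have hτττ : (τ ≫ τ ≫ τ) ≫ π = π := by rw [Category.assoc, hττ, hτπ]
  have h4s : fiberOverEnd π τ hτπ s ≫ fiberOverEnd π τ hτπ s ≫ fiberOverEnd π τ hτπ s ≫ fiberOverEnd π τ hτπ s = 𝟙 (fiberOver π s) := by
    rw [← fiberOverEnd_comp π τ τ hτπ hτπ s, ← fiberOverEnd_comp π τ (τ ≫ τ) hτπ hττ s,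
      ← fiberOverEnd_comp π τ (τ ≫ τ ≫ τ) hτπ hτττ s, ← fiberOverEnd_id π s]
    exact fiberOverEnd_congr π h4 _ _ s
  change AlgPoints.map _ (AlgPoints.map _ (AlgPoints.map _ (AlgPoints.map _ x))) = x
  rw [← AlgPoints.map_comp_apply, ← AlgPoints.map_comp_apply, ← AlgPoints.map_comp_apply]
  rw [h4s, AlgPoints.map_id_apply]

/-- `τ_s(ℂ) ∘ j_s(ℂ) ∘ τ_s(ℂ) = j_s(ℂ)` on the points of the fibre, from `τ ≫ j ≫ τ = j`. [cite: Fulton1998, §10.1] -/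
theorem mapContinuous_fiberOverEnd_τjτ_apply {j : 𝒳 ⟶ 𝒳} (hjπ : j ≫ π = π) (hτjτ : τ ≫ j ≫ τ = j) (s : AlgPoints S ℂ)
    (x : ComplexPoints (fiberOver π s)) :
    AlgPoints.mapContinuous (L := ℂ) (fiberOverEnd π τ hτπ s) (AlgPoints.mapContinuous (L := ℂ) (fiberOverEnd π j hjπ s)
      (AlgPoints.mapContinuous (L := ℂ) (fiberOverEnd π τ hτπ s) x)) = AlgPoints.mapContinuous (L := ℂ) (fiberOverEnd π j hjπ s) x := by
  have hjτ : (j ≫ τ) ≫ π = π := by rw [Category.assoc, hτπ, hjπ]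
  have h3 : fiberOverEnd π τ hτπ s ≫ fiberOverEnd π j hjπ s ≫ fiberOverEnd π τ hτπ s = fiberOverEnd π j hjπ s := by
    rw [← fiberOverEnd_comp π j τ hjπ hτπ s, ← fiberOverEnd_comp π τ (j ≫ τ) hτπ hjτ s]
    exact fiberOverEnd_congr π hτjτ _ _ s
  change AlgPoints.map _ (AlgPoints.map _ (AlgPoints.map _ x)) = AlgPoints.map _ x
  rw [← AlgPoints.map_comp_apply, ← AlgPoints.map_comp_apply, h3]

/-- **K1Q stub S5 (v6) at a point `s` from the local configuration of a monodromy homeomorphism** (model-free homological form; see the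
module docstring). [cite: VoisinHodgeII2003, §3.1.2 and §3.2.1] [cite: ArnoldGuseinzadeVarchenko2012, Part I §1.1] [cite: Bredon1993, Ch. VI Thm. 11.10] -/
theorem monodromyBireflection_of_localConfiguration (hπ : IsSmoothProjectiveFamily π 2) (h𝒳 : IsQuasiProjectiveOver 𝒳)
    (hS : IsQuasiProjectiveOver S) {j : 𝒳 ⟶ 𝒳} (hjπ : j ≫ π = π) (h4 : τ ≫ τ ≫ τ ≫ τ = 𝟙 𝒳) (hjj : j ≫ j = τ ≫ τ)
    (hτjτ : τ ≫ j ≫ τ = j) (hU : IsCohomologicallyLocallyTrivialOn π (Set.univ : Set (ComplexPoints S))) (s : ComplexPoints S)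
    (γ : bettiCohomology (fiberOver π s) 2 ≃ₗ[ℚ] bettiCohomology (fiberOver π s) 2)
    (hγΓ : γ ∈ ratMonodromyGroup π 2 hU ⟨s, Set.mem_univ s⟩)
    (hγ1 : ∃ a, pull (fiberOverEnd π τ hτπ s) 2 (pull (fiberOverEnd π τ hτπ s) 2 a) = -a ∧ γ a ≠ a)
    (h : ComplexPoints (fiberOver π s) ≃ₜ ComplexPoints (fiberOver π s))
    (hγh : ∀ a, γ a = (singularCohomology.map ℚ ℚ (h : C(ComplexPoints (fiberOver π s), ComplexPoints (fiberOver π s))) 2).hom a)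
    (hhμ : singularHomology.map ℚ ℚ (h : C(ComplexPoints (fiberOver π s), ComplexPoints (fiberOver π s))) 4
      (complexOrientationRat (hπ.isSmoothProjective s)).fundamentalClass = (complexOrientationRat (hπ.isSmoothProjective s)).fundamentalClass)
    (hhτ : ∀ x, h (AlgPoints.mapContinuous (L := ℂ) (fiberOverEnd π τ hτπ s) x) = AlgPoints.mapContinuous (L := ℂ) (fiberOverEnd π τ hτπ s) (h x))
    {A₁ A₂ B : Set (ComplexPoints (fiberOver π s))} (h1o : IsOpen A₁) (h2o : IsOpen A₂) (hBo : IsOpen B) (hcov : A₁ ∪ A₂ ∪ B = univ)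
    (hdisj : Disjoint (closure A₁) A₂) (hB : ∀ x ∈ B, h x = x)
    (hhA₁ : MapsTo (h : C(ComplexPoints (fiberOver π s), ComplexPoints (fiberOver π s))) A₁ A₁)
    (hhA₂ : MapsTo (h : C(ComplexPoints (fiberOver π s), ComplexPoints (fiberOver π s))) A₂ A₂)
    (hτA₁ : MapsTo (AlgPoints.mapContinuous (L := ℂ) (fiberOverEnd π τ hτπ s)) A₁ A₁)
    (hτA₂ : MapsTo (AlgPoints.mapContinuous (L := ℂ) (fiberOverEnd π τ hτπ s)) A₂ A₂)
    (hjA₁ : MapsTo (AlgPoints.mapContinuous (L := ℂ) (fiberOverEnd π j hjπ s)) A₁ A₂)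
    (hjA₂ : MapsTo (AlgPoints.mapContinuous (L := ℂ) (fiberOverEnd π j hjπ s)) A₂ A₁)
    [Module.Finite ℚ (singularHomology ℚ ℚ (↥A₁) 2)] [Module.Finite ℚ (singularHomology ℚ ℚ (↥A₂) 2)]
    (hrank₁ : finrank ℚ ↥(Module.End.eigenspace
      ((singularHomology.map ℚ ℚ (singularHomology.restrictSelf (AlgPoints.mapContinuous (L := ℂ) (fiberOverEnd π τ hτπ s)) hτA₁) 2).hom ^ 2)
      (-1 : ℚ)) ≤ 2)
    (hloc₁ : ∀ a : singularHomology ℚ ℚ (↥A₁) 2,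
      singularHomology.map ℚ ℚ (singularHomology.restrictSelf (AlgPoints.mapContinuous (L := ℂ) (fiberOverEnd π τ hτπ s)) hτA₁) 2
        (singularHomology.map ℚ ℚ (singularHomology.restrictSelf (AlgPoints.mapContinuous (L := ℂ) (fiberOverEnd π τ hτπ s)) hτA₁) 2 a) = -a →
      singularHomology.map ℚ ℚ (singularHomology.restrictSelf (h : C(ComplexPoints (fiberOver π s), ComplexPoints (fiberOver π s))) hhA₁) 2 a =
        singularHomology.map ℚ ℚ (singularHomology.restrictSelf (AlgPoints.mapContinuous (L := ℂ) (fiberOverEnd π τ hτπ s)) hτA₁) 2 a)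
    (hloc₂ : ∀ a : singularHomology ℚ ℚ (↥A₂) 2,
      singularHomology.map ℚ ℚ (singularHomology.restrictSelf (AlgPoints.mapContinuous (L := ℂ) (fiberOverEnd π τ hτπ s)) hτA₂) 2
        (singularHomology.map ℚ ℚ (singularHomology.restrictSelf (AlgPoints.mapContinuous (L := ℂ) (fiberOverEnd π τ hτπ s)) hτA₂) 2 a) = -a →
      singularHomology.map ℚ ℚ (singularHomology.restrictSelf (h : C(ComplexPoints (fiberOver π s), ComplexPoints (fiberOver π s))) hhA₂) 2
        (singularHomology.map ℚ ℚ (singularHomology.restrictSelf (AlgPoints.mapContinuous (L := ℂ) (fiberOverEnd π τ hτπ s)) hτA₂) 2 a) = a) :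
    let Xs := fiberOver π s
    let hXs : IsSmoothProjective 2 Xs := hπ.isSmoothProjective s
    let A : bettiCohomology Xs 2 →ₗ[ℚ] bettiCohomology Xs 2 := pull (fiberOverEnd π τ hτπ s) 2
    let B : bettiCohomology Xs 2 →ₗ[ℚ] bettiCohomology Xs 2 := pull (fiberOverEnd π j hjπ s) 2
    let Qf : LinearMap.BilinForm ℚ (bettiCohomology Xs 2) := LinearMap.compr₂ (cup Xs 2 2) (tr hXs (2 + 2))
    let Γ := ratMonodromyGroup π 2 hU ⟨s, Set.mem_univ s⟩
    ∃ γ ∈ Γ, ∃ ℓp ℓm : TensorProduct ℚ ℂ (bettiCohomology Xs 2),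
      ℓp ∈ (Module.End.eigenspace (A ^ 2) (-1)).baseChange ℂ ∧ ℓm ∈ (Module.End.eigenspace (A ^ 2) (-1)).baseChange ℂ ∧
      A.baseChange ℂ ℓp = Complex.I • ℓp ∧ A.baseChange ℂ ℓm = Complex.I • ℓm ∧ (Qf.baseChange ℂ) ℓp (B.baseChange ℂ ℓm) ≠ 0 ∧
      (γ.toLinearMap.baseChange ℂ) ℓp = Complex.I • ℓp ∧ (γ.toLinearMap.baseChange ℂ) ℓm = (-Complex.I) • ℓm ∧
      ∀ x ∈ (Module.End.eigenspace (A ^ 2) (-1)).baseChange ℂ, A.baseChange ℂ x = Complex.I • x →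
        (Qf.baseChange ℂ) x (B.baseChange ℂ ℓp) = 0 → (Qf.baseChange ℂ) x (B.baseChange ℂ ℓm) = 0 → (γ.toLinearMap.baseChange ℂ) x = x := by
  have hdisj' : Disjoint A₁ A₂ := hdisj.mono_left subset_closure
  obtain ⟨htW₁, htW₂, htt₁, htt₂, hjW₁, hjW₂, hvar, hh₁, hh₂, hle₁, hle₂, hrk₁, -⟩ :=
    singularHomology.twoPiecesKernelDatum h1o h2o hBo hcov hdisj'
      (h : C(ComplexPoints (fiberOver π s), ComplexPoints (fiberOver π s)))
      (AlgPoints.mapContinuous (L := ℂ) (fiberOverEnd π τ hτπ s)) (AlgPoints.mapContinuous (L := ℂ) (fiberOverEnd π j hjπ s))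
      hB hhA₁ hhA₂ hτA₁ hτA₂ hjA₁ hjA₂ (mapContinuous_fiberOverEnd_pow_four_apply π hτπ h4 s) hhτ
      (mapContinuous_fiberOverEnd_τjτ_apply π hτπ hjπ hτjτ s) 2 hloc₁ hloc₂
  exact monodromyBireflection_of_twoBallDatum_of_ne_one_ker π hτπ hπ h𝒳 hS hjπ h4 hjj hτjτ hU s γ hγΓ hγ1 h hγh hhμ
    (bijective_poincareDualityMap_complexOrientationRat_two (hπ.isSmoothProjective s)) _ _ (hrk₁.trans hrank₁) htW₁ htW₂ htt₁ htt₂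
    hjW₁ hjW₂ hvar hh₁ hh₂
    (fun a b ha hb => tr_cup_eq_zero_of_disjoint_carriers_two (hπ.isSmoothProjective s) hdisj a b (hle₁ ha) (hle₂ hb))

end Summit.HodgeConjecture.HodgeConjecture.Theorems.Q8MonodromyBireflectionAssembly

end
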